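import Summits.Ventures.YMGap.Thresholds.OneLinkCasimirTwo
import Summits.Ventures.YMGap.Thresholds.OneLinkPoissonCovariance
import HarnessLib

/-!
# Venture YMGap — the one-link modulus beyond first order, part 6: FLUCTUATION scales under `ν_B` — the gradient-form
# Poincaré inequality for smooth statistics and the JOINT `Re/Im` bound for a complex linear statistic

HONEST FRAMING: venture file of the cell `pub-ymgap` (QuantumFields programme), strong-coupling LATTICE bookkeeping for `SU(N)`
lattice Yang–Mills; nothing about the continuum or the mass gap in the Clay sense.  No number of record («F4», part 2, of the cell
note `HOME/p2/ONE-LINK-HIERARCHY.md` §4, refinement (R1)).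

WHAT.  `ν_B(dg) ∝ exp(N Re tr(gB)) dg` on `SU(N)`, `‖B‖_op < 1/2`, `ρ = N(1/2 − ‖B‖_op)` (Bakry–Émery).
* `variance_restrict_le_integral_Gam`: `Var_ν(f) ≤ (∫ Γ(f,f) dν)/ρ` for every smooth `f` (the tree's weighted-Haar `poincare_pot` rewritten
  for the tilted probability measure).
* `variance_re_add_variance_im_le`: `Var_ν Re tr(gM) + Var_ν Im tr(gM) ≤ ‖M‖_F²/ρ` — NOT `2‖M‖_F²/ρ`: the two carrés du champ add up to
  `‖M‖_F² − |tr(gM)|²/N ≤ ‖M‖_F²` pointwise (`Gam_pot_pot_su`, `Gam_pot_negI_negI`).  This is the fluctuation scale `1/√ρ` of every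
  trace factor `tr(Δg)`, `tr(Bg)` in the second-order bound (cell note (4.5)–(4.6)).

References: Bakry–Gentil–Ledoux, Grundlehren 348, Prop. 4.8.1; Shen–Zhu–Zhu CMP 400 (2023) §4.1; cell note §4.
-/

noncomputable section

open scoped Matrix ComplexConjugate BigOperators ContDiff Matrix.Norms.Frobenius
open Matrix Complex Finset MeasureTheory ProbabilityTheory
open Literature.MathematicalPhysics.QuantumFieldTheory
open Literature.MathematicalPhysics.QuantumFieldTheory.SUNBakryEmery

namespace Summit.Ventures.YMGap.OneLinkEigen

variable {N : ℕ}

/-- **Gradient-form Poincaré inequality under `ν_B`**: for smooth `f`, `Var_ν(f|_{SU(N)}) ≤ (∫ Γ(f,f) dν)/(N(1/2 − ‖B‖_op))`.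
[cite: arXiv220412737, Lemma 4.1 with (4.4)-(4.6)] -/
theorem variance_restrict_le_integral_Gam (hN : N ≠ 0) {B : Matrix (Fin N) (Fin N) ℂ} (hB : matrixOpNorm B < 1 / 2)
    {f : Matrix (Fin N) (Fin N) ℂ → ℝ} (hf : ContDiff ℝ ∞ f) :
    Var[fun g : SUN N => f g; (haarProbability (SUN N)).tilted (fun g => (N : ℝ) * ((g : Matrix (Fin N) (Fin N) ℂ) * B).trace.re)] ≤
      (∫ g, Gam f f g ∂(haarProbability (SUN N)).tilted (fun g => (N : ℝ) * ((g : Matrix (Fin N) (Fin N) ℂ) * B).trace.re)) /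
        ((N : ℝ) * (1 / 2 - matrixOpNorm B)) := by
  have hNpos : (0 : ℝ) < N := Nat.cast_pos.2 (Nat.pos_of_ne_zero hN)
  set R : ℝ := matrixOpNorm B with hRdef
  have hRpos : 0 < 1 / 2 - R := by linarith
  set S : Matrix (Fin N) (Fin N) ℂ → ℝ := pot (N : ℝ) B with hSdef
  have hS : ContDiff ℝ ∞ S := contDiff_pot _ B
  set ν : Measure (SUN N) :=
    (haarProbability (SUN N)).tilted (fun g => (N : ℝ) * ((g : Matrix (Fin N) (Fin N) ℂ) * B).trace.re) with hν
  have hexpc : Continuous fun g : SUN N => Real.exp (S g) := Real.continuous_exp.comp (continuous_restrict hS)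
  have hexpi : Integrable (fun g : SUN N => Real.exp ((N : ℝ) * ((g : Matrix (Fin N) (Fin N) ℂ) * B).trace.re))
      (haarProbability (SUN N)) := integrable_of_continuous_SUN hexpc _
  haveI : IsProbabilityMeasure ν := isProbabilityMeasure_tilted hexpi
  set Z : ℝ := ∫ g : SUN N, Real.exp (S g) ∂(haarSU N) with hZ
  have hZpos : 0 < Z := integral_exp_pos (integrable_of_continuous_SUN hexpc _)
  have htilt : ∀ h : SUN N → ℝ, ∫ g, h g ∂ν = (∫ g : SUN N, Real.exp (S g) * h g ∂(haarSU N)) / Z := fun h => by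
    rw [hν]; exact integral_tilted_eq_div _ h
  have hfc : Continuous fun g : SUN N => f g := continuous_restrict hf
  have hK : 0 < (N : ℝ) * (1 / 2 - R) := mul_pos hNpos hRpos
  have hK' : 0 < (N : ℝ) / 2 - |(N : ℝ)| * matrixOpNorm B := by rw [abs_of_pos hNpos]; nlinarith
  have hP := poincare_pot hN (N : ℝ) B hK' hf
  set m : ℝ := (∫ g : SUN N, Real.exp (pot (N : ℝ) B g) * f g ∂(haarSU N)) /
    (∫ g : SUN N, Real.exp (pot (N : ℝ) B g) ∂(haarSU N)) with hm
  have hmean : ∫ g, f g ∂ν = m := by rw [htilt]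
  have hvar : Var[fun g : SUN N => f g; ν] = (∫ g : SUN N, Real.exp (S g) * (f g - m) ^ 2 ∂(haarSU N)) / Z := by
    rw [ProbabilityTheory.variance_eq_integral hfc.aemeasurable, hmean, htilt]
  have hKeq : (N : ℝ) / 2 - |(N : ℝ)| * matrixOpNorm B = (N : ℝ) * (1 / 2 - R) := by
    rw [abs_of_pos hNpos, hRdef]; ring
  rw [hKeq] at hP
  set G : ℝ := ∫ g, Gam f f g ∂ν with hG
  rw [hvar, div_le_div_iff₀ hZpos hK, hG, htilt, div_mul_eq_mul_div, le_div_iff₀ hZpos]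
  calc (∫ g : SUN N, Real.exp (S g) * (f g - m) ^ 2 ∂(haarSU N)) * ((N : ℝ) * (1 / 2 - R)) * Z
      = ((N : ℝ) * (1 / 2 - R) * ∫ g : SUN N, Real.exp (pot (N : ℝ) B g) * (f g - m) ^ 2 ∂(haarSU N)) * Z := by
        rw [hSdef]; ring
    _ ≤ (∫ g : SUN N, Real.exp (pot (N : ℝ) B g) * Gam f f g ∂(haarSU N)) * Z :=
        mul_le_mul_of_nonneg_right hP hZpos.le
    _ = (∫ g : SUN N, Real.exp (S g) * Gam f f g ∂(haarSU N)) * Z := by rw [hSdef]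

/-- The two carrés du champ of a complex linear statistic add up to at most `‖M‖_F²` on `SU(N)`:
`Γ(Re tr(·M)) + Γ(Im tr(·M)) = ‖M‖_F² − |tr(gM)|²/N ≤ ‖M‖_F²`. [folklore] -/
theorem Gam_re_add_Gam_im_le (hN : N ≠ 0) (M : Matrix (Fin N) (Fin N) ℂ) (g : SUN N) :
    Gam (pot 1 M) (pot 1 M) g + Gam (pot 1 ((-I) • M)) (pot 1 ((-I) • M)) g ≤ frobNorm M ^ 2 := by
  rw [Gam_pot_pot_su hN, Gam_pot_negI_negI hN, mul_su_mul_conjTranspose]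
  have hF : (M * Mᴴ).trace.re = frobNorm M ^ 2 := by
    rw [frobNorm_sq_eq_re_trace, trace_mul_comm]
  rw [hF]
  have hN' : (0 : ℝ) < N := Nat.cast_pos.2 (Nat.pos_of_ne_zero hN)
  have h1 : 0 ≤ (1 / (N : ℝ)) * ((M * (g : Matrix (Fin N) (Fin N) ℂ)).trace.im * (M * (g : Matrix (Fin N) (Fin N) ℂ)).trace.im) :=
    mul_nonneg (by positivity) (mul_self_nonneg _)
  have h2 : 0 ≤ (1 / (N : ℝ)) * ((M * (g : Matrix (Fin N) (Fin N) ℂ)).trace.re * (M * (g : Matrix (Fin N) (Fin N) ℂ)).trace.re) :=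
    mul_nonneg (by positivity) (mul_self_nonneg _)
  nlinarith [h1, h2]

/-- **Joint `Re/Im` fluctuation bound**: `Var_ν Re tr(gM) + Var_ν Im tr(gM) ≤ ‖M‖_F² / (N(1/2 − ‖B‖_op))` — the complex statistic
`tr(gM)` fluctuates on the scale `‖M‖_F/√ρ` (not `√2 ‖M‖_F/√ρ`). [folklore] -/
theorem variance_re_add_variance_im_le (hN : N ≠ 0) {B : Matrix (Fin N) (Fin N) ℂ} (hB : matrixOpNorm B < 1 / 2)
    (M : Matrix (Fin N) (Fin N) ℂ) :
    Var[fun g : SUN N => ((g : Matrix (Fin N) (Fin N) ℂ) * M).trace.re;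
        (haarProbability (SUN N)).tilted (fun g => (N : ℝ) * ((g : Matrix (Fin N) (Fin N) ℂ) * B).trace.re)] +
      Var[fun g : SUN N => ((g : Matrix (Fin N) (Fin N) ℂ) * M).trace.im;
        (haarProbability (SUN N)).tilted (fun g => (N : ℝ) * ((g : Matrix (Fin N) (Fin N) ℂ) * B).trace.re)] ≤
      frobNorm M ^ 2 / ((N : ℝ) * (1 / 2 - matrixOpNorm B)) := by
  have hNpos : (0 : ℝ) < N := Nat.cast_pos.2 (Nat.pos_of_ne_zero hN)
  have hK : 0 < (N : ℝ) * (1 / 2 - matrixOpNorm B) := mul_pos hNpos (by linarith)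
  set ν : Measure (SUN N) :=
    (haarProbability (SUN N)).tilted (fun g => (N : ℝ) * ((g : Matrix (Fin N) (Fin N) ℂ) * B).trace.re) with hν
  have hexpi : Integrable (fun g : SUN N => Real.exp ((N : ℝ) * ((g : Matrix (Fin N) (Fin N) ℂ) * B).trace.re))
      (haarProbability (SUN N)) :=
    integrable_of_continuous_SUN (Real.continuous_exp.comp (continuous_restrict (contDiff_pot (N : ℝ) B))) _
  haveI : IsProbabilityMeasure ν := isProbabilityMeasure_tilted hexpi
  have h1 := variance_restrict_le_integral_Gam hN hB (contDiff_pot 1 M) (N := N)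
  have h2 := variance_restrict_le_integral_Gam hN hB (contDiff_pot 1 ((-I) • M)) (N := N)
  rw [← hν] at h1 h2
  have e1 : (fun g : SUN N => pot 1 M (g : Matrix (Fin N) (Fin N) ℂ)) = fun g : SUN N => ((g : Matrix (Fin N) (Fin N) ℂ) * M).trace.re := by
    funext g; simp only [pot, one_mul]
  have e2 : (fun g : SUN N => pot 1 ((-I) • M) (g : Matrix (Fin N) (Fin N) ℂ)) =
      fun g : SUN N => ((g : Matrix (Fin N) (Fin N) ℂ) * M).trace.im := by
    funext g; simp only [pot, one_mul, re_trace_mul_negI_smul]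
  rw [e1] at h1
  rw [e2] at h2
  have iG1 : Integrable (fun g : SUN N => Gam (pot 1 M) (pot 1 M) g) ν :=
    integrable_of_continuous_SUN (continuous_restrict (contDiff_Gam (contDiff_pot 1 M) (contDiff_pot 1 M))) ν
  have iG2 : Integrable (fun g : SUN N => Gam (pot 1 ((-I) • M)) (pot 1 ((-I) • M)) g) ν :=
    integrable_of_continuous_SUN (continuous_restrict (contDiff_Gam (contDiff_pot 1 _) (contDiff_pot 1 _))) ν
  have hsum : ∫ g, Gam (pot 1 M) (pot 1 M) g ∂ν + ∫ g, Gam (pot 1 ((-I) • M)) (pot 1 ((-I) • M)) g ∂ν ≤ frobNorm M ^ 2 := by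
    rw [← integral_add iG1 iG2]
    calc ∫ g, (Gam (pot 1 M) (pot 1 M) g + Gam (pot 1 ((-I) • M)) (pot 1 ((-I) • M)) g) ∂ν
        ≤ ∫ g, frobNorm M ^ 2 ∂ν := integral_mono (iG1.add iG2) (integrable_const _) fun g => Gam_re_add_Gam_im_le hN M g
      _ = frobNorm M ^ 2 := by simp
  calc _ ≤ (∫ g, Gam (pot 1 M) (pot 1 M) g ∂ν) / ((N : ℝ) * (1 / 2 - matrixOpNorm B)) +
        (∫ g, Gam (pot 1 ((-I) • M)) (pot 1 ((-I) • M)) g ∂ν) / ((N : ℝ) * (1 / 2 - matrixOpNorm B)) := add_le_add h1 h2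
    _ = (∫ g, Gam (pot 1 M) (pot 1 M) g ∂ν + ∫ g, Gam (pot 1 ((-I) • M)) (pot 1 ((-I) • M)) g ∂ν) /
        ((N : ℝ) * (1 / 2 - matrixOpNorm B)) := by rw [add_div]
    _ ≤ frobNorm M ^ 2 / ((N : ℝ) * (1 / 2 - matrixOpNorm B)) := div_le_div_of_nonneg_right hsum hK.le

end Summit.Ventures.YMGap.OneLinkEigen
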